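import Literature.AlgebraicGeometry.HodgeTheory.FermatJuxtapositionSpans
import Literature.AlgebraicGeometry.HodgeTheory.FermatAokiRepresentsAllFromOne
import Literature.AlgebraicGeometry.HodgeTheory.GysinBaseChangeOfKunneth
import HarnessLib

/-!
# The right cone-span leaf of Aoki's Thm. 1-4 (i) follows from the left one

Family `hodge`, layer `Literature/AlgebraicGeometry/HodgeTheory`. PROOF FILE (theorems only; no
definition, no named fact). Of the two cone-span inputs of the tree's assembly
`Aoki1987_claim_juxtaposition_holds_of` (`FermatJuxtapositionSpans`: N. Aoki, J. Math. Soc. Japan 39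
(1987), Thm. 1-4 (i) with `r = 0` resp. `s = 0`, p. 388 "non-negative even integers"; T. Shioda,
Math. Ann. 245 (1979), Thm. I), the right one `Shioda1979_coneSpan_represents_right` (cones over
`X1 = {y = 0} ≅ X²ʳₘ` with vertices the `m` points of `X⁰ₘ`, representing `α∗β` for `α` a Hodge
character of `X²ʳₘ` and `β = (b, -b)` one of `X⁰ₘ`) is the MIRROR IMAGE of the left one
`Shioda1979_coneSpan_represents_left` (representing `β∗α`) under the permutation of the coordinates
of `X^{2(r+1)}ₘ` carrying the juxtaposition `β∗α` to `α∗β` (Aoki 1987, §1: "`α ∼ β`", equality up to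
permutation of the components; Shioda 1979, §1, the symmetric group acting on `Xⁿₘ`). PROVED here:

* `coneSpan_index_transport` — bookkeeping: the conclusion of the left leaf, stated at the ambient
  index `2 · k` with `k = r + 1`, is moved to the literal index `2 (r + 1)` (the two leaves spell the
  dimension `2 (0 + r + 1)` resp. `2 (r + 0 + 1)`), keeping the multiset of values of the character;
* `complexGysin_permAut_eq_smul_map` — for a permutation `σ` of the coordinates of `Xⁿₘ` and the
  automorphism `p_{σ⁻¹}` (`permAut`), the Gysin image `(p_{σ⁻¹})_* c` is `d • p_σ^* c` for a scalar
  `d` (projection formula `g_*(g^* x ∪ 1) = x ∪ g_* 1`, `g_* 1 ∈ H⁰ = ℂ · 1`, and `p_{σ⁻¹}^* p_σ^* = id`),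
  for every orientation family;
* `fermatProjector_complexGysin_comp_permAut_ne_zero` — **`π_δ((φ ≫ p_{σ⁻¹})_* y) ≠ 0` as soon as
  `π_{δ∘σ}(φ_* y) ≠ 0`**: `(φ ≫ g)_* = g_* ∘ φ_*`, the previous lemma, `π_δ ∘ p_σ^* = p_σ^* ∘ π_{δ∘σ}`
  (`fermatProjector_map_permMap`), and the injectivity of `g_*` and of `p_σ^*` for the automorphism
  `g = p_{σ⁻¹}`;
* `Shioda1979_coneSpan_represents_right_of_left` — **the right leaf from the left leaf**: apply the
  left leaf to `(β, α)`, keep the span `X²ʳₘ ←π— E`, and replace `φ : E → X^{2(r+1)}ₘ` by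
  `φ ≫ p_{σ⁻¹}` for a permutation `σ` with `(α∗β) ∘ σ = β∗α` (same multiset of values,
  `exists_perm_eq_comp_of_univ_val_map_eq`).

Consequently the cone-span input of `Aoki1987_claim_juxtaposition` reduces to the single named fact
`Shioda1979_coneSpan_represents_left`.

## References

* [Aoki1987] N. Aoki, Some new algebraic cycles on Fermat varieties, J. Math. Soc. Japan 39 (1987),
  §1 ("`α ∼ β`"), Thm. 1-4 (i) p. 388.
* [Shioda1979HodgeFermat] T. Shioda, The Hodge conjecture for Fermat varieties, Math. Ann. 245
  (1979), §1 and Thm. I.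
* [FultonYoungTableaux1997] W. Fulton, Young Tableaux, CUP 1997, Appendix B §B.1 (2), (5), (6).
-/

noncomputable section

open CategoryTheory AlgebraicGeometry Finset
open Literature.AlgebraicGeometry.Motives Literature.AlgebraicTopology.SingularHomology

namespace Literature.AlgebraicGeometry.HodgeTheory

/-! ### Bookkeeping of the ambient index -/

/-- **Index transport for the conclusion of a cone-span leaf**: a non-vanishing
`π_δ(φ_* π^* w) ≠ 0` on `X^{2k}ₘ` with `k = r + 1` is the same statement on `X^{2(r+1)}ₘ`, for a
character with the same multiset of values (in fact the same character). [folklore] -/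
theorem coneSpan_index_transport {m r k : ℕ} [NeZero m] (hk : r + 1 = k) (μ : OrientationFamily)
    {e : ℕ} {E : Motives.SchemeOver ℂ} (hE : IsSmoothProjective e E)
    (hX : IsSmoothProjective (2 * k) (fermatHypersurface (2 * k) m))
    (π : E ⟶ fermatHypersurface (2 * r) m) (φ : E ⟶ fermatHypersurface (2 * k) m)
    (δ : Fin (2 * k + 2) → ZMod m) (hdeg : 2 * r + 2 * (2 * k) = 2 * k + 2 * e)
    (w : complexBetti (fermatHypersurface (2 * r) m) (2 * r))
    (h : fermatProjector m δ (2 * k) (complexGysin μ hE hX φ hdeg (complexBetti.map π (2 * r) w)) ≠ 0) :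
    ∃ (hX' : IsSmoothProjective (2 * (r + 1)) (fermatHypersurface (2 * (r + 1)) m))
      (φ' : E ⟶ fermatHypersurface (2 * (r + 1)) m) (δ' : Fin (2 * (r + 1) + 2) → ZMod m)
      (hdeg' : 2 * r + 2 * (2 * (r + 1)) = 2 * (r + 1) + 2 * e),
      univ.val.map δ' = univ.val.map δ ∧
        fermatProjector m δ' (2 * (r + 1))
          (complexGysin μ hE hX' φ' hdeg' (complexBetti.map π (2 * r) w)) ≠ 0 := by
  subst hk
  exact ⟨hX, φ, δ, hdeg, rfl, h⟩

/-! ### Gysin images under the coordinate permutations `p_σ` -/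

section Perm

variable {m n : ℕ} (μ : OrientationFamily)

/-- **`(p_{σ⁻¹})_* c = d • p_σ^* c`** on `Hᵏ(Xⁿₘ(ℂ); ℂ)` for some scalar `d`, for the automorphism
`p_{σ⁻¹}` of `Xⁿₘ` induced by a permutation `σ` of the coordinates and any orientation family:
`c = p_{σ⁻¹}^*(p_σ^* c)`, the projection formula `g_*(g^* x ∪ 1) = x ∪ g_* 1`, and
`g_* 1 ∈ H⁰(Xⁿₘ(ℂ); ℂ) = ℂ · 1`. [cite: FultonYoungTableaux1997, Appendix B §B.1 (5) and (6)]
[cite: Shioda1979HodgeFermat, §1] -/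
theorem complexGysin_permAut_eq_smul_map [NeZero m] (hX : IsSmoothProjective n (fermatHypersurface n m))
    (σ : Equiv.Perm (Fin (n + 2))) (k : ℕ) :
    ∃ d : ℂ, ∀ c : complexBetti (fermatHypersurface n m) k,
      complexGysin μ hX hX
          (permAut (fermatPolynomial ℂ n m) (inv_mem (mem_permStabilizer_fermatPolynomial m σ)))
          (rfl : k + 2 * n = k + 2 * n) c =
        d • complexBetti.map (permAut (fermatPolynomial ℂ n m) (mem_permStabilizer_fermatPolynomial m σ)) k c := by
  have hμ : μ.HasPoincareDuality := OrientationFamily.hasPoincareDuality μ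
  set g := permAut (fermatPolynomial ℂ n m) (inv_mem (mem_permStabilizer_fermatPolynomial m σ)) with hg
  set g' := permAut (fermatPolynomial ℂ n m) (mem_permStabilizer_fermatPolynomial m σ) with hg'
  obtain ⟨d, hd⟩ := exists_eq_smul_one μ hX
    (complexGysin μ hX hX g (rfl : 0 + 2 * n = 0 + 2 * n) (singularCohomology.one ℂ (ComplexPoints _)))
  refine ⟨d, fun c ↦ ?_⟩
  -- `c = g^* (g'^* c)`
  have hinv : complexBetti.map g k (complexBetti.map g' k c) = c :=
    map_permMap_inv_map_permMap (mem_permStabilizer_fermatPolynomial m σ) k c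
  have key := complexGysin_cup hμ hX hX g (p := k) (q := 0) (a := k) (b := k) (q' := 0)
    (Nat.add_zero k) rfl rfl (Nat.add_zero k) (complexBetti.map g' k c)
    (singularCohomology.one ℂ (ComplexPoints _))
  rw [hinv, hd, cupProduct_one' ℂ (Nat.add_zero k), LinearMap.map_smul,
    cupProduct_one' ℂ (Nat.add_zero k)] at key
  exact key

/-- **`π_δ((φ ≫ p_{σ⁻¹})_* y) ≠ 0` if `π_{δ∘σ}(φ_* y) ≠ 0`**, for `φ : E ⟶ Xⁿₘ` from a smooth
projective `E`, a permutation `σ` of the coordinates and every orientation family: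
`(φ ≫ g)_* = g_* ∘ φ_*` (`g = p_{σ⁻¹}`), `g_* c = d • p_σ^* c`, `π_δ(p_σ^* c) = p_σ^*(π_{δ∘σ} c)`
(`fermatProjector_map_permMap`); if the result vanished, either `d = 0`, so `g_* c = 0` and `c = 0`
(`g'_* ∘ g_* = (g ≫ g')_* = 𝟙_* = id` for `g' = p_σ`), or `p_σ^*(π_{δ∘σ} c) = 0` and
`π_{δ∘σ} c = p_{σ⁻¹}^*(p_σ^*(π_{δ∘σ} c)) = 0`. [cite: Shioda1979HodgeFermat, §1]
[cite: FultonYoungTableaux1997, Appendix B §B.1 (2), (5) and (6)] -/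
theorem fermatProjector_complexGysin_comp_permAut_ne_zero [NeZero m]
    (hX : IsSmoothProjective n (fermatHypersurface n m)) {e : ℕ} {E : Motives.SchemeOver ℂ}
    (hE : IsSmoothProjective e E) (φ : E ⟶ fermatHypersurface n m) (σ : Equiv.Perm (Fin (n + 2)))
    (δ : Fin (n + 2) → ZMod m) {a : ℕ} (ha : a + 2 * n = n + 2 * e) (y : complexBetti E a)
    (h : fermatProjector m (δ ∘ σ) n (complexGysin μ hE hX φ ha y) ≠ 0) :
    fermatProjector m δ n (complexGysin μ hE hX
      (φ ≫ permAut (fermatPolynomial ℂ n m) (inv_mem (mem_permStabilizer_fermatPolynomial m σ)))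
      ha y) ≠ 0 := by
  have hμ : μ.HasPoincareDuality := OrientationFamily.hasPoincareDuality μ
  set g := permAut (fermatPolynomial ℂ n m) (inv_mem (mem_permStabilizer_fermatPolynomial m σ)) with hg
  set g' := permAut (fermatPolynomial ℂ n m) (mem_permStabilizer_fermatPolynomial m σ) with hg'
  set c := complexGysin μ hE hX φ ha y with hc
  obtain ⟨d, hd⟩ := complexGysin_permAut_eq_smul_map μ hX σ n
  -- `(φ ≫ g)_* y = g_* c = d • g'^* c`
  have hcomp : complexGysin μ hE hX (φ ≫ g) ha y =
      complexGysin μ hX hX g (rfl : n + 2 * n = n + 2 * n) c := by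
    rw [complexGysin_comp hμ hE hX hX φ g ha rfl, LinearMap.comp_apply]
  -- the projector commutes with `g'^*` up to `σ`
  have hproj : fermatProjector m δ n (complexBetti.map g' n c) =
      complexBetti.map g' n (fermatProjector m (δ ∘ σ) n c) :=
    fermatProjector_map_permMap δ σ c
  intro h0
  rw [hcomp, hd c, LinearMap.map_smul, hproj] at h0
  rcases smul_eq_zero.mp h0 with hd0 | hzero
  · -- `d = 0`: `g_* = 0`, but `g_*` is injective
    have hgg' : g ≫ g' = 𝟙 _ := Over.OverMorphism.ext (by
      rw [Over.comp_left, Over.id_left]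
      exact permAut_left_inv_comp _ (mem_permStabilizer_fermatPolynomial m σ))
    have hid : complexGysin μ hX hX g' (rfl : n + 2 * n = n + 2 * n)
        (complexGysin μ hX hX g (rfl : n + 2 * n = n + 2 * n) c) = c := by
      have h1 := complexGysin_comp hμ hX hX hX g g' (a := n) (b := n) (c := n) rfl rfl
      rw [hgg', complexGysin_id hμ hX n] at h1
      have h2 := congrArg (fun f : complexBetti (fermatHypersurface n m) n →ₗ[ℂ]
        complexBetti (fermatHypersurface n m) n ↦ f c) h1
      simpa using h2.symm
    have hc0 : c = 0 := by
      rw [← hid, hd c, hd0, zero_smul, map_zero]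
    exact h (by rw [hc0, map_zero])
  · -- `g'^*(π_{δ∘σ} c) = 0`: apply `g^*`
    have h2 := congrArg (complexBetti.map g n) hzero
    rw [map_zero] at h2
    exact h ((map_permMap_inv_map_permMap (mem_permStabilizer_fermatPolynomial m σ) n _).symm.trans h2)

end Perm

/-! ### The right leaf from the left leaf -/

/-- **`Shioda1979_coneSpan_represents_left → Shioda1979_coneSpan_represents_right`** (the cones over
`X1 = {y = 0}` are the cones over `X2 = {x = 0}` read through the permutation of the coordinates
exchanging the two blocks; Aoki 1987, Thm. 1-4 (i) with `s = 0`, and §1 "`α ∼ β`"): given `α` Hodge on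
`X²ʳₘ` (`r ≥ 1`) and `β = (b, -b)` on `X⁰ₘ`, the left leaf for `(β, α)` supplies a span
`X²ʳₘ ←π— E —φ→ X^{2(r+1)}ₘ` and `v ∈ V(α)` with `π_{β∗α}(φ_* π^* v) ≠ 0`; for a permutation `σ`
with `(α∗β) ∘ σ = β∗α` (same multiset of values) the span `X²ʳₘ ←π— E —(φ ≫ p_{σ⁻¹})→ X^{2(r+1)}ₘ`
has `π_{α∗β}((φ ≫ p_{σ⁻¹})_* π^* v) ≠ 0` (`fermatProjector_complexGysin_comp_permAut_ne_zero`).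
[cite: Aoki1987, Thm. 1-4 (i) p. 388 and §1] [cite: Shioda1979HodgeFermat, §1 and Thm. I] -/
theorem Shioda1979_coneSpan_represents_right_of_left (hleft : Shioda1979_coneSpan_represents_left) :
    Shioda1979_coneSpan_represents_right := by
  classical
  intro m r _ α β hr hα hβ
  obtain ⟨μ, e, E, hE, hX, π, hπ, φ, he, w, hw, hne⟩ := hleft m r β α hr hβ hα
  obtain ⟨hX', φ', δ', hdeg', hval, hne'⟩ :=
    coneSpan_index_transport (k := 0 + r + 1) (by omega) μ hE hX π φ (FermatCharacter.append β α)
      _ w hne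
  -- a permutation `σ` with `δ' = (α∗β) ∘ σ`
  have hval' : univ.val.map (FermatCharacter.append α β) = univ.val.map δ' := by
    rw [hval, FermatCharacter.univ_val_map_append, FermatCharacter.univ_val_map_append, add_comm]
  obtain ⟨σ, hσ⟩ := FermatCharacter.exists_perm_eq_comp_of_univ_val_map_eq hval'
  refine ⟨μ, e, E, hE, hX', π, hπ,
    φ' ≫ permAut (fermatPolynomial ℂ (2 * (r + 1)) m)
      (inv_mem (mem_permStabilizer_fermatPolynomial m σ)), he, w, hw, ?_⟩
  have key := fermatProjector_complexGysin_comp_permAut_ne_zero μ hX' hE φ' σ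
    (FermatCharacter.append α β) hdeg' (complexBetti.map π (2 * r) w) (by rw [← hσ]; exact hne')
  exact key

end Literature.AlgebraicGeometry.HodgeTheory

end
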